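import Summits.ABC.IUTFork.Thm311RealInd1StripGlobalStrictness
import HarnessLib

/-!
# [IUTchIII] Thm 3.11 (i) (Ind1)+(Ind2) ⟶ Cor 3.12, GLOBAL level, IDENTITY SIDE — reading (U) twin: the nonarchimedean Θ-side of the (Ind1)-slot-union
# reading over print's (Ind1)⊔(Ind2) AS TYPED equals Dupuy–Hilado's `−|log(Θ)|^{nonarch}` iff it does so PRIME BY PRIME; at a tame support prime `p > 2` of
# odd local degree `≥ 3` iff every collection has room at SOME content-minimising slot (⟹ UNCONDITIONAL, ⟸ mod `JannsenWingbergMappingClass`); localisation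
# at the residual support primes (`2 ∈ T(I)` always); and the NON-VACUITY of the prime-indexed family hypotheses

PROOF-ONLY file (abc-iut cell, Cor. 3.12 sub-crew, seat abc-iut-c312-1 = holder of record of the typed [IUTchIII] Thm. 3.11, gen 23; offer (τ)
«C:GLOBAL-IDENTITY-LOCALISATION», file 2 of 2 — the reading-(U) twin of `Thm311RealInd1StripGlobalDichotomy` over the same parent p588683, plus §5).  TAKES NO
SIDE on [IUTchIII] Cor. 3.12.  No definition, no `Prop` fact.  `JannsenWingbergMappingClass` enters ONLY §3; §1, §2, §4, §5 UNCONDITIONAL; §2's ⟹ theorem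
carries NO parity / bit-witness / strip-move binder.  SETTING as file 1, reading (U): `negLogThetaNonarch I = Σ_{p∈T(I)} negLogThetaLoc I p`, claim form
`Cor312NonarchOf I`, the Θ-side over `H` INLINE with the (Ind1)-slot union `⋃_σ σ·O_𝕃(−P_Θ)_{v⃗∘σ}` (abc-iut-c312-d1's shape).
* §1 (UNCONDITIONAL) **`sum_lnνLp_hull_orbitH_indOneUnion_eq_negLogThetaNonarch_iff_forall_eq`** (prime-by-prime reduction, `Finset.sum_eq_sum_iff_of_le` over
  p588683 §1) and **`lnνLp_hull_orbitH_indOneUnion_eq_negLogThetaLoc_two_of_sum_eq`** (the global identity forces the summand identity at `p = 2 ∈ T(I)`).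
* §2 (UNCONDITIONAL) **`forall_exists_room_at_min_of_sum_lnνLp_hull_orbitH_indOneUnion_eq_negLogThetaNonarch`**: the global identity forces, at every tame support
  prime `p₀ > 2` with no place of local degree one, EVERY collection to have room at SOME content-minimising slot (contrapositive of p588683 §3 (U)).
* §3 (mod `JannsenWingbergMappingClass`) **`dif_lnνLp_hull_orbitH_indOneUnion_eq_negLogThetaLoc_of_forall_exists_room_at_min_…`** (one tame support prime of odd
  local degree `≥ 3`: all collections pass ⟹ summand identity; p588176 §2) and the LOCALISATION
  **`sum_lnνLp_hull_orbitH_indOneUnion_eq_negLogThetaNonarch_iff_forall_eq_sdiff_of_forall_exists_room_at_min_…`** (for `P ⊆ T(I)` passing: GLOBAL identity ⟺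
  summand identity on `T(I) \ P ∋ 2`).
* §4 **`negAbsLogQ_le_sum_indOneUnion_iff_cor312NonarchOf_of_sum_eq`** (on the identity locus «Cor 3.12's (U)-form over `H`» ⟺ `Cor312NonarchOf I`).
* §5 NON-VACUITY (UNCONDITIONAL) **`exists_primeIndexedFamily_le_indTwo_stripMoves_factorwise`**: ONE prime-indexed family `H` meeting `H ≤ indTwo`, the
  strip moves and the factorwise action at EVERY prime at once (p587766 §4 under `choose`); the arithmetic hypotheses are NOT witnessed here.
READING (neutral; OUR typed objects) as file 1, for reading (U): beyond the tame-odd rows the identity branch lives at `p = 2`, at the wild and at the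
even-degree support primes — nothing claimed there; which value a bit takes is NOT claimed; equal-AS-TYPED ≠ equal in print; nothing here asserts that abc is
proved or refuted; no side taken on [IUTchIII] Cor. 3.12 / [IUTchIV] Thm. 1.10, on (U) vs (P), or on any author. [claim: Mochizuki2012, status: disputed];
[cite: Mochizuki2012, IUTchIII Thm. 3.11 (i) p. 154; Cor. 3.12 pp. 173–174, Step (xi) p. 183; IUTchIV Thm. 1.10 Steps (v)–(viii) pp. 27–31, Prop. 1.4 (iii)
p. 13]; [cite: DupuyHilado2025, §1 (1.1), Def. 3.6.3, §3.9, §4.7, §4.11, §4.12]. typed ≠ proved; a conditional theorem discharges nothing it binds.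
-/

set_option autoImplicit false
noncomputable section
open Metric Set Function Module
open scoped Pointwise TensorProduct

namespace Literature.IUT.LogVolume.ThetaVolumeInput

open Summit.ABC.IUTFork.Thm311.Real Literature.NumberTheory.NumberFields Function
open Literature.NumberTheory.GaloisRepresentations Literature.NumberTheory.GaloisRepresentations.Ultrametric
open Literature.AnabelianGeometry.AbsoluteAnabelian Literature.IUT.HodgeArakelov
open Literature.IUT.HodgeArakelov.AbsTopMonoids NumberField IsDedekindDomain

variable {F₀ : Type} [Field F₀] [NumberField F₀] {K : Type} [Field K] [NumberField K] [Algebra F₀ K]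
variable (I : ThetaVolumeInput F₀ K)

/-- **PRIME-BY-PRIME REDUCTION, reading (U) (UNCONDITIONAL).**  For ANY prime-indexed family `H ≤ indTwo`, the nonarchimedean Θ-side of reading (U) over `H`
EQUALS `−|log(Θ)|^{nonarch}` iff its guarded `p`-summand equals `negLogThetaLoc I p` at every `p ∈ T(I)` (termwise `≤` by p588683 §1;
`Finset.sum_eq_sum_iff_of_le`). [claim: Mochizuki2012, status: disputed] [cite: Mochizuki2012, IUTchIII Cor. 3.12 p. 174; IUTchIV Thm. 1.10 Step (viii) p. 31]
[cite: DupuyHilado2025, §1 (1.1), Def. 3.6.3, §4.11, §4.12] -/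
theorem sum_lnνLp_hull_orbitH_indOneUnion_eq_negLogThetaNonarch_iff_forall_eq
    (H : ∀ (p : ℕ) (hp : p.Prime), haveI : Fact p.Prime := ⟨hp⟩
      (j : ℕ) → (e : Fin (j + 1) → placesOver F₀ p) →
        Subgroup (PacketAlgebra p (fun b => (I.σ.localFields p).k (e b)) ≃ₗ[ℚ_[p]]
          PacketAlgebra p (fun b => (I.σ.localFields p).k (e b))))
    (hH : ∀ (p : ℕ) (hp : p.Prime), haveI : Fact p.Prime := ⟨hp⟩; ∀ j e, H p hp j e ≤ indTwo p (fun b => (I.σ.localFields p).k (e b))) :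
    (∑ p ∈ I.supportPrimes, if hp : p.Prime then
        (haveI : Fact p.Prime := ⟨hp⟩
        (I.packetAt p hp).lnνLp I.lstar (fun j e =>
          packetHull p (fun b => (I.σ.localFields p).k (e b))
            (⋃ g : H p hp j e, (g : PacketAlgebra p (fun b => (I.σ.localFields p).k (e b)) ≃ₗ[ℚ_[p]]
                PacketAlgebra p (fun b => (I.σ.localFields p).k (e b))) ''
              ⋃ τ : Equiv.Perm (Fin (j + 1)), (I.packetAt p hp).perm τ e '' (I.packetAt p hp).pilotRegion (I.tΘ p hp) j (e ∘ τ)))) else 0) =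
      I.negLogThetaNonarch ↔
    ∀ p ∈ I.supportPrimes, (if hp : p.Prime then
        (haveI : Fact p.Prime := ⟨hp⟩
        (I.packetAt p hp).lnνLp I.lstar (fun j e =>
          packetHull p (fun b => (I.σ.localFields p).k (e b))
            (⋃ g : H p hp j e, (g : PacketAlgebra p (fun b => (I.σ.localFields p).k (e b)) ≃ₗ[ℚ_[p]]
                PacketAlgebra p (fun b => (I.σ.localFields p).k (e b))) ''
              ⋃ τ : Equiv.Perm (Fin (j + 1)), (I.packetAt p hp).perm τ e '' (I.packetAt p hp).pilotRegion (I.tΘ p hp) j (e ∘ τ)))) else 0) =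
      I.negLogThetaLoc p := by
  unfold negLogThetaNonarch
  refine Finset.sum_eq_sum_iff_of_le fun p hpT => ?_
  have hp : p.Prime := I.prime_of_mem_supportPrimes hpT
  rw [dif_pos hp]
  exact I.lnνLp_hull_orbitH_indOneUnion_le_negLogThetaLoc hp (H p hp) (hH p hp)

/-- **The global identity of reading (U) is decided ALSO at `p = 2 ∈ T(I)` (UNCONDITIONAL):** it forces `ln ν̄_{𝕃_2}(reading (U) over H_2) = negLogThetaLoc I 2`;
no R-row speaks about this summand. [claim: Mochizuki2012, status: disputed] [cite: Mochizuki2012, IUTchIV Thm. 1.10 Step (vi) p. 29] [cite: DupuyHilado2025, §3.9] -/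
theorem lnνLp_hull_orbitH_indOneUnion_eq_negLogThetaLoc_two_of_sum_eq
    (H : ∀ (p : ℕ) (hp : p.Prime), haveI : Fact p.Prime := ⟨hp⟩
      (j : ℕ) → (e : Fin (j + 1) → placesOver F₀ p) →
        Subgroup (PacketAlgebra p (fun b => (I.σ.localFields p).k (e b)) ≃ₗ[ℚ_[p]]
          PacketAlgebra p (fun b => (I.σ.localFields p).k (e b))))
    (hH : ∀ (p : ℕ) (hp : p.Prime), haveI : Fact p.Prime := ⟨hp⟩; ∀ j e, H p hp j e ≤ indTwo p (fun b => (I.σ.localFields p).k (e b)))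
    (hEq : (∑ p ∈ I.supportPrimes, if hp : p.Prime then
        (haveI : Fact p.Prime := ⟨hp⟩
        (I.packetAt p hp).lnνLp I.lstar (fun j e =>
          packetHull p (fun b => (I.σ.localFields p).k (e b))
            (⋃ g : H p hp j e, (g : PacketAlgebra p (fun b => (I.σ.localFields p).k (e b)) ≃ₗ[ℚ_[p]]
                PacketAlgebra p (fun b => (I.σ.localFields p).k (e b))) ''
              ⋃ τ : Equiv.Perm (Fin (j + 1)), (I.packetAt p hp).perm τ e '' (I.packetAt p hp).pilotRegion (I.tΘ p hp) j (e ∘ τ)))) else 0) =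
      I.negLogThetaNonarch) :
    haveI : Fact (2 : ℕ).Prime := ⟨Nat.prime_two⟩
    (I.packetAt 2 Nat.prime_two).lnνLp I.lstar (fun j e =>
        packetHull 2 (fun b => (I.σ.localFields 2).k (e b))
          (⋃ g : H 2 Nat.prime_two j e, (g : PacketAlgebra 2 (fun b => (I.σ.localFields 2).k (e b)) ≃ₗ[ℚ_[2]]
              PacketAlgebra 2 (fun b => (I.σ.localFields 2).k (e b))) ''
            ⋃ τ : Equiv.Perm (Fin (j + 1)), (I.packetAt 2 Nat.prime_two).perm τ e ''
              (I.packetAt 2 Nat.prime_two).pilotRegion (I.tΘ 2 Nat.prime_two) j (e ∘ τ))) =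
      I.negLogThetaLoc 2 := by
  simpa only [dif_pos Nat.prime_two] using
    (I.sum_lnνLp_hull_orbitH_indOneUnion_eq_negLogThetaNonarch_iff_forall_eq H hH).mp hEq 2 I.two_mem_supportPrimes

/-- **GLOBAL IDENTITY (U) ⟹ EVERY COLLECTION HAS ROOM AT SOME CONTENT-MINIMISING SLOT, at every tame support prime (UNCONDITIONAL; no
`JannsenWingbergMappingClass`, no parity, no bit witness, no strip move).**  Let the nonarchimedean Θ-side of reading (U) over a prime-indexed `H ≤ indTwo`
EQUAL `−|log(Θ)|^{nonarch}`.  Then at every support prime `p₀ > 2` over which every place of the section is tame of local degree `≥ 2`, for every slot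
valuation family `‖t_{i,v_a}‖ = p₀^{−v(i,v⃗,a)/e(v̲_a|p₀)}`, every bit oracle with `hfix` at the residue-degree-one places it leaves off, and `H_{p₀,v⃗}`
factorwise, EVERY collection `(i,v⃗)` has a slot `a` with `A(i,v⃗,a) = min A(i,v⃗,·)` and `((v(i,v⃗,a)−1) % e + 1)/e + Σ_{b : f = 1 ∧ ¬bit} 1/e(v̲_b|p₀) ≤ 1`
(contrapositive of p588683 §3 (U) after p587766's `S`-conversion). [claim: Mochizuki2012, status: disputed] [cite: Mochizuki2012, IUTchIII Thm. 3.11 (i) p. 154;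
Cor. 3.12 p. 174; IUTchIV Prop. 1.4 (iii) p. 13] [cite: DupuyHilado2025, §1 (1.1), Def. 3.6.3, §4.11, §4.12] -/
theorem forall_exists_room_at_min_of_sum_lnνLp_hull_orbitH_indOneUnion_eq_negLogThetaNonarch
    (H : ∀ (p : ℕ) (hp : p.Prime), haveI : Fact p.Prime := ⟨hp⟩
      (j : ℕ) → (e : Fin (j + 1) → placesOver F₀ p) →
        Subgroup (PacketAlgebra p (fun b => (I.σ.localFields p).k (e b)) ≃ₗ[ℚ_[p]]
          PacketAlgebra p (fun b => (I.σ.localFields p).k (e b))))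
    (hH : ∀ (p : ℕ) (hp : p.Prime), haveI : Fact p.Prime := ⟨hp⟩; ∀ j e, H p hp j e ≤ indTwo p (fun b => (I.σ.localFields p).k (e b)))
    (hEq : (∑ p ∈ I.supportPrimes, if hp : p.Prime then
        (haveI : Fact p.Prime := ⟨hp⟩
        (I.packetAt p hp).lnνLp I.lstar (fun j e =>
          packetHull p (fun b => (I.σ.localFields p).k (e b))
            (⋃ g : H p hp j e, (g : PacketAlgebra p (fun b => (I.σ.localFields p).k (e b)) ≃ₗ[ℚ_[p]]
                PacketAlgebra p (fun b => (I.σ.localFields p).k (e b))) ''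
              ⋃ τ : Equiv.Perm (Fin (j + 1)), (I.packetAt p hp).perm τ e '' (I.packetAt p hp).pilotRegion (I.tΘ p hp) j (e ∘ τ)))) else 0) =
      I.negLogThetaNonarch)
    {p₀ : ℕ} (hp₀T : p₀ ∈ I.supportPrimes) (hp₀ : p₀.Prime) (hp2 : 2 < p₀)
    (he : haveI : Fact p₀.Prime := ⟨hp₀⟩; ∀ w : placesOver F₀ p₀, absRamificationIdx p₀ ((I.σ.localFields p₀).k w) ≤ p₀ - 2)
    (h2 : haveI : Fact p₀.Prime := ⟨hp₀⟩; ∀ w : placesOver F₀ p₀, 2 ≤ localDeg K (I.σ.lift w.1))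
    (v : (i : Fin I.lstar) → (Fin ((i : ℕ) + 1 + 1) → placesOver F₀ p₀) → Fin ((i : ℕ) + 1 + 1) → ℤ)
    (hv : haveI : Fact p₀.Prime := ⟨hp₀⟩; ∀ (i : Fin I.lstar) (e : Fin ((i : ℕ) + 1 + 1) → placesOver F₀ p₀) (a : Fin ((i : ℕ) + 1 + 1)),
      ‖(I.tΘ p₀ hp₀ i (e a) : (I.σ.localFieldFamily p₀ hp₀).k (e a))‖ =
        (p₀ : ℝ) ^ (-(v i e a / (absRamificationIdx p₀ ((I.σ.localFields p₀).k (e a)) : ℝ))))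
    (bit : placesOver F₀ p₀ → Prop) [DecidablePred bit]
    (hfix : haveI : Fact p₀.Prime := ⟨hp₀⟩; ∀ w : placesOver F₀ p₀, (I.σ.lift w.1).asIdeal.inertiaDeg ℤ = 1 → ¬ bit w →
      ∀ ψ ∈ ind1StripOf (I.σ.lift w.1) (galoisLog (I.σ.lift w.1)),
        RescaledCompletion.of K p₀ (I.σ.lift w.1) (I.σ.natCast_mem_lift w) (ψ (p₀ : (I.σ.lift w.1).adicCompletion K)) -
            (p₀ : RescaledCompletion K p₀ (I.σ.lift w.1) (I.σ.natCast_mem_lift w)) ∈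
          (p₀ : ℚ_[p₀]) • logUnits (RescaledCompletion K p₀ (I.σ.lift w.1) (I.σ.natCast_mem_lift w)))
    (hHfac : haveI : Fact p₀.Prime := ⟨hp₀⟩
      ∀ (i : Fin I.lstar) (e : Fin ((i : ℕ) + 1 + 1) → placesOver F₀ p₀), ∀ γ ∈ H p₀ hp₀ ((i : ℕ) + 1) e,
        ∃ δ : Π b, AddAut ((I.σ.lift (e b).1).adicCompletion K),
          (∀ b, δ b ∈ AddSubgroup.closure (G := AddAut ((I.σ.lift (e b).1).adicCompletion K))
            (ind1StripOf (I.σ.lift (e b).1) (galoisLog (I.σ.lift (e b).1)))) ∧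
          ∀ z : Π b, (I.σ.localFields p₀).k (e b),
            (γ : PacketAlgebra p₀ (fun b => (I.σ.localFields p₀).k (e b)) ≃ₗ[ℚ_[p₀]]
                PacketAlgebra p₀ (fun b => (I.σ.localFields p₀).k (e b))) (PiTensorProduct.tprod ℚ_[p₀] z) =
              PiTensorProduct.tprod ℚ_[p₀] (fun b => RescaledCompletion.of K p₀ (I.σ.lift (e b).1) (I.σ.natCast_mem_lift (e b))
                (δ b ((RescaledCompletion.of K p₀ (I.σ.lift (e b).1) (I.σ.natCast_mem_lift (e b))).symm (z b))))) :
    haveI : Fact p₀.Prime := ⟨hp₀⟩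
    ∀ (i : Fin I.lstar) (e : Fin ((i : ℕ) + 1 + 1) → placesOver F₀ p₀), ∃ a,
      (v i e a - 1) / (absRamificationIdx p₀ ((I.σ.localFields p₀).k (e a)) : ℤ) + 1 - Fintype.card (Fin ((i : ℕ) + 1 + 1)) =
          Finset.univ.inf' Finset.univ_nonempty
            (fun a => (v i e a - 1) / (absRamificationIdx p₀ ((I.σ.localFields p₀).k (e a)) : ℤ) + 1 - Fintype.card (Fin ((i : ℕ) + 1 + 1))) ∧
        (((v i e a - 1) % (absRamificationIdx p₀ ((I.σ.localFields p₀).k (e a)) : ℤ) + 1 : ℤ) : ℝ) /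
            (absRamificationIdx p₀ ((I.σ.localFields p₀).k (e a)) : ℝ) +
          ∑ b ∈ Finset.univ \ Finset.univ.filter (fun b => (I.σ.lift (e b).1).asIdeal.inertiaDeg ℤ ≠ 1 ∨ bit (e b)),
            (1 : ℝ) / (absRamificationIdx p₀ ((I.σ.localFields p₀).k (e b)) : ℝ) ≤ 1 := by
  haveI : Fact p₀.Prime := ⟨hp₀⟩
  classical
  intro i₁ e₁
  by_contra hnot
  set S : Finset (Fin ((i₁ : ℕ) + 1 + 1)) :=
    Finset.univ.filter (fun b => (I.σ.lift (e₁ b).1).asIdeal.inertiaDeg ℤ ≠ 1 ∨ bit (e₁ b)) with hS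
  have hmemS : ∀ b, b ∈ S ↔ (I.σ.lift (e₁ b).1).asIdeal.inertiaDeg ℤ ≠ 1 ∨ bit (e₁ b) := fun b => by simp [hS]
  have hfS : ∀ b, b ∉ S → (I.σ.lift (e₁ b).1).asIdeal.inertiaDeg ℤ = 1 := fun b hb => by
    by_contra h; exact hb ((hmemS b).mpr (Or.inl h))
  have hbS : ∀ b, b ∉ S → ¬ bit (e₁ b) := fun b hb hbit' => hb ((hmemS b).mpr (Or.inr hbit'))
  have he2 : ∀ b, b ∉ S → 2 ≤ absRamificationIdx p₀ ((I.σ.localFields p₀).k (e₁ b)) := fun b hb => by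
    have h := h2 (e₁ b)
    rw [localDeg, hfS b hb, mul_one, ← absRamificationIdx_rescaledCompletion K p₀ (I.σ.lift (e₁ b).1) (I.σ.natCast_mem_lift (e₁ b))] at h
    exact h
  have hnot' : ∀ a, (v i₁ e₁ a - 1) / (absRamificationIdx p₀ ((I.σ.localFields p₀).k (e₁ a)) : ℤ) + 1 - Fintype.card (Fin ((i₁ : ℕ) + 1 + 1)) =
      Finset.univ.inf' Finset.univ_nonempty
        (fun a => (v i₁ e₁ a - 1) / (absRamificationIdx p₀ ((I.σ.localFields p₀).k (e₁ a)) : ℤ) + 1 - Fintype.card (Fin ((i₁ : ℕ) + 1 + 1))) →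
    ¬ ((((v i₁ e₁ a - 1) % (absRamificationIdx p₀ ((I.σ.localFields p₀).k (e₁ a)) : ℤ) + 1 : ℤ) : ℝ) /
        (absRamificationIdx p₀ ((I.σ.localFields p₀).k (e₁ a)) : ℝ) +
      ∑ b ∈ Finset.univ \ S, (1 : ℝ) / (absRamificationIdx p₀ ((I.σ.localFields p₀).k (e₁ b)) : ℝ) ≤ 1) :=
    fun a ha hr => hnot ⟨a, ha, hr⟩
  have hlt := I.sum_lnνLp_hull_orbitH_indOneUnion_lt_negLogThetaNonarch_of_not_room_at_min H hH hp₀T hp₀ hp2 i₁ e₁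
    (fun b => he (e₁ b)) (v i₁ e₁) (hv i₁ e₁) S he2 hfS (fun b hb => hfix (e₁ b) (hfS b hb) (hbS b hb)) hnot' (hHfac i₁ e₁)
  rw [hEq] at hlt
  exact lt_irrefl _ hlt

/-- **ONE TAME SUPPORT PRIME OF ODD LOCAL DEGREE `≥ 3`, reading (U): all collections pass ⟹ summand identity (mod `JannsenWingbergMappingClass`).**  At a
prime `p > 2` over which every place of the section is tame of odd local degree `≥ 3`, with slot valuations, a bit oracle correct at the residue-degree-one
places, and `H_p ≤ indTwo` with the strip moves, factorwise: if EVERY collection has room at SOME content-minimising slot, the guarded `p`-summand of the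
reading-(U) Θ-side over `H` equals `negLogThetaLoc I p` (p588176 §2, ⟸). [claim: Mochizuki2012, status: disputed]
[cite: Mochizuki2012, IUTchIII Cor. 3.12 p. 174, Step (xi) p. 183] [cite: DupuyHilado2025, Def. 3.6.3, §4.7, §4.11, §4.12] -/
theorem dif_lnνLp_hull_orbitH_indOneUnion_eq_negLogThetaLoc_of_forall_exists_room_at_min_of_jannsenWingbergMappingClass
    (hMC : JannsenWingbergMappingClass) {p : ℕ} (hp : p.Prime) (hp2 : 2 < p)
    (he : haveI : Fact p.Prime := ⟨hp⟩; ∀ w : placesOver F₀ p, absRamificationIdx p ((I.σ.localFields p).k w) ≤ p - 2)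
    (h3 : haveI : Fact p.Prime := ⟨hp⟩; ∀ w : placesOver F₀ p, 3 ≤ localDeg K (I.σ.lift w.1))
    (hodd : haveI : Fact p.Prime := ⟨hp⟩; ∀ w : placesOver F₀ p, Odd (localDeg K (I.σ.lift w.1)))
    (v : (i : Fin I.lstar) → (Fin ((i : ℕ) + 1 + 1) → placesOver F₀ p) → Fin ((i : ℕ) + 1 + 1) → ℤ)
    (hv : haveI : Fact p.Prime := ⟨hp⟩; ∀ (i : Fin I.lstar) (e : Fin ((i : ℕ) + 1 + 1) → placesOver F₀ p) (a : Fin ((i : ℕ) + 1 + 1)),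
      ‖(I.tΘ p hp i (e a) : (I.σ.localFieldFamily p hp).k (e a))‖ = (p : ℝ) ^ (-(v i e a / (absRamificationIdx p ((I.σ.localFields p).k (e a)) : ℝ))))
    (bit : placesOver F₀ p → Prop) [DecidablePred bit]
    (hbit : haveI : Fact p.Prime := ⟨hp⟩; ∀ w : placesOver F₀ p, (I.σ.lift w.1).asIdeal.inertiaDeg ℤ = 1 → bit w →
      ∃ ψ ∈ ind1StripOf (I.σ.lift w.1) (galoisLog (I.σ.lift w.1)),
        RescaledCompletion.of K p (I.σ.lift w.1) (I.σ.natCast_mem_lift w) (ψ (p : (I.σ.lift w.1).adicCompletion K)) -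
            (p : RescaledCompletion K p (I.σ.lift w.1) (I.σ.natCast_mem_lift w)) ∉
          (p : ℚ_[p]) • logUnits (RescaledCompletion K p (I.σ.lift w.1) (I.σ.natCast_mem_lift w)))
    (hfix : haveI : Fact p.Prime := ⟨hp⟩; ∀ w : placesOver F₀ p, (I.σ.lift w.1).asIdeal.inertiaDeg ℤ = 1 → ¬ bit w →
      ∀ ψ ∈ ind1StripOf (I.σ.lift w.1) (galoisLog (I.σ.lift w.1)),
        RescaledCompletion.of K p (I.σ.lift w.1) (I.σ.natCast_mem_lift w) (ψ (p : (I.σ.lift w.1).adicCompletion K)) -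
            (p : RescaledCompletion K p (I.σ.lift w.1) (I.σ.natCast_mem_lift w)) ∈
          (p : ℚ_[p]) • logUnits (RescaledCompletion K p (I.σ.lift w.1) (I.σ.natCast_mem_lift w)))
    (H : haveI : Fact p.Prime := ⟨hp⟩
      (j : ℕ) → (e : Fin (j + 1) → placesOver F₀ p) →
        Subgroup (PacketAlgebra p (fun b => (I.σ.localFields p).k (e b)) ≃ₗ[ℚ_[p]]
          PacketAlgebra p (fun b => (I.σ.localFields p).k (e b))))
    (hH : haveI : Fact p.Prime := ⟨hp⟩; ∀ j e, H j e ≤ indTwo p (fun b => (I.σ.localFields p).k (e b)))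
    (hstrip : haveI : Fact p.Prime := ⟨hp⟩
      ∀ (i : Fin I.lstar) (e : Fin ((i : ℕ) + 1 + 1) → placesOver F₀ p) (b₀ : Fin ((i : ℕ) + 1 + 1)),
        ∀ ψ ∈ ind1StripOf (I.σ.lift (e b₀).1) (galoisLog (I.σ.lift (e b₀).1)), ∃ γ ∈ H ((i : ℕ) + 1) e,
          ∀ z : ∀ b, (I.σ.localFields p).k (e b),
            (γ : PacketAlgebra p (fun b => (I.σ.localFields p).k (e b)) ≃ₗ[ℚ_[p]]
                PacketAlgebra p (fun b => (I.σ.localFields p).k (e b))) (PiTensorProduct.tprod ℚ_[p] z) =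
              PiTensorProduct.tprod ℚ_[p] (update z b₀
                (RescaledCompletion.of K p (I.σ.lift (e b₀).1) (I.σ.natCast_mem_lift (e b₀))
                  (ψ ((RescaledCompletion.of K p (I.σ.lift (e b₀).1) (I.σ.natCast_mem_lift (e b₀))).symm (z b₀))))))
    (hHfac : haveI : Fact p.Prime := ⟨hp⟩
      ∀ (i : Fin I.lstar) (e : Fin ((i : ℕ) + 1 + 1) → placesOver F₀ p), ∀ γ ∈ H ((i : ℕ) + 1) e,
        ∃ δ : Π b, AddAut ((I.σ.lift (e b).1).adicCompletion K),
          (∀ b, δ b ∈ AddSubgroup.closure (G := AddAut ((I.σ.lift (e b).1).adicCompletion K))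
            (ind1StripOf (I.σ.lift (e b).1) (galoisLog (I.σ.lift (e b).1)))) ∧
          ∀ z : Π b, (I.σ.localFields p).k (e b),
            (γ : PacketAlgebra p (fun b => (I.σ.localFields p).k (e b)) ≃ₗ[ℚ_[p]]
                PacketAlgebra p (fun b => (I.σ.localFields p).k (e b))) (PiTensorProduct.tprod ℚ_[p] z) =
              PiTensorProduct.tprod ℚ_[p] (fun b => RescaledCompletion.of K p (I.σ.lift (e b).1) (I.σ.natCast_mem_lift (e b))
                (δ b ((RescaledCompletion.of K p (I.σ.lift (e b).1) (I.σ.natCast_mem_lift (e b))).symm (z b)))))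
    (hroom : haveI : Fact p.Prime := ⟨hp⟩; ∀ (i : Fin I.lstar) (e : Fin ((i : ℕ) + 1 + 1) → placesOver F₀ p), ∃ a,
      (v i e a - 1) / (absRamificationIdx p ((I.σ.localFields p).k (e a)) : ℤ) + 1 - Fintype.card (Fin ((i : ℕ) + 1 + 1)) =
          Finset.univ.inf' Finset.univ_nonempty
            (fun a => (v i e a - 1) / (absRamificationIdx p ((I.σ.localFields p).k (e a)) : ℤ) + 1 - Fintype.card (Fin ((i : ℕ) + 1 + 1))) ∧
        (((v i e a - 1) % (absRamificationIdx p ((I.σ.localFields p).k (e a)) : ℤ) + 1 : ℤ) : ℝ) /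
            (absRamificationIdx p ((I.σ.localFields p).k (e a)) : ℝ) +
          ∑ b ∈ Finset.univ \ Finset.univ.filter (fun b => (I.σ.lift (e b).1).asIdeal.inertiaDeg ℤ ≠ 1 ∨ bit (e b)),
            (1 : ℝ) / (absRamificationIdx p ((I.σ.localFields p).k (e b)) : ℝ) ≤ 1) :
    (if hp' : p.Prime then
        (haveI : Fact p.Prime := ⟨hp'⟩
        (I.packetAt p hp').lnνLp I.lstar (fun j e =>
          packetHull p (fun b => (I.σ.localFields p).k (e b))
            (⋃ g : H j e, (g : PacketAlgebra p (fun b => (I.σ.localFields p).k (e b)) ≃ₗ[ℚ_[p]]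
                PacketAlgebra p (fun b => (I.σ.localFields p).k (e b))) ''
              ⋃ τ : Equiv.Perm (Fin (j + 1)), (I.packetAt p hp').perm τ e '' (I.packetAt p hp').pilotRegion (I.tΘ p hp') j (e ∘ τ)))) else 0) =
      I.negLogThetaLoc p := by
  rw [dif_pos hp]
  exact (I.lnνLp_hull_orbitH_indOneUnion_eq_negLogThetaLoc_iff_forall_exists_room_at_min_of_jannsenWingbergMappingClass hMC hp hp2 he h3 hodd v
    hv bit hbit hfix H hH hstrip hHfac).mpr hroom

/-- **LOCALISATION OF THE GLOBAL IDENTITY, reading (U) (mod `JannsenWingbergMappingClass`).**  Let `P ⊆ T(I)` consist of support primes `> 2` over each of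
which every place of the section is tame of odd local degree `≥ 3` (slot valuation families, bit oracles, `H_p ≤ indTwo` with the strip moves, factorwise),
and let every collection over every `p ∈ P` have room at some content-minimising slot.  Then the GLOBAL identity of reading (U) holds iff the guarded
summand identity holds at every RESIDUAL support prime `p ∈ T(I) \ P ∋ 2`; nothing is claimed about those summands. [claim: Mochizuki2012, status: disputed]
[cite: Mochizuki2012, IUTchIII Cor. 3.12 p. 174; IUTchIV Thm. 1.10 Steps (vi)/(viii) pp. 29–31] [cite: DupuyHilado2025, §1 (1.1), §3.9, Def. 3.6.3, §4.11, §4.12] -/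
theorem sum_lnνLp_hull_orbitH_indOneUnion_eq_negLogThetaNonarch_iff_forall_eq_sdiff_of_forall_exists_room_at_min_of_jannsenWingbergMappingClass
    (hMC : JannsenWingbergMappingClass)
    (H : ∀ (p : ℕ) (hp : p.Prime), haveI : Fact p.Prime := ⟨hp⟩
      (j : ℕ) → (e : Fin (j + 1) → placesOver F₀ p) →
        Subgroup (PacketAlgebra p (fun b => (I.σ.localFields p).k (e b)) ≃ₗ[ℚ_[p]]
          PacketAlgebra p (fun b => (I.σ.localFields p).k (e b))))
    (hH : ∀ (p : ℕ) (hp : p.Prime), haveI : Fact p.Prime := ⟨hp⟩; ∀ j e, H p hp j e ≤ indTwo p (fun b => (I.σ.localFields p).k (e b)))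
    (P : Finset ℕ) (hPT : P ⊆ I.supportPrimes) (hP2 : ∀ p ∈ P, 2 < p)
    (he : ∀ p ∈ P, ∀ hp : p.Prime, haveI : Fact p.Prime := ⟨hp⟩; ∀ w : placesOver F₀ p, absRamificationIdx p ((I.σ.localFields p).k w) ≤ p - 2)
    (h3 : ∀ p ∈ P, ∀ w : placesOver F₀ p, 3 ≤ localDeg K (I.σ.lift w.1))
    (hodd : ∀ p ∈ P, ∀ w : placesOver F₀ p, Odd (localDeg K (I.σ.lift w.1)))
    (v : (p : ℕ) → (i : Fin I.lstar) → (Fin ((i : ℕ) + 1 + 1) → placesOver F₀ p) → Fin ((i : ℕ) + 1 + 1) → ℤ)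
    (hv : ∀ p ∈ P, ∀ hp : p.Prime, haveI : Fact p.Prime := ⟨hp⟩; ∀ (i : Fin I.lstar) (e : Fin ((i : ℕ) + 1 + 1) → placesOver F₀ p) (a : Fin ((i : ℕ) + 1 + 1)),
      ‖(I.tΘ p hp i (e a) : (I.σ.localFieldFamily p hp).k (e a))‖ = (p : ℝ) ^ (-(v p i e a / (absRamificationIdx p ((I.σ.localFields p).k (e a)) : ℝ))))
    (bit : (p : ℕ) → placesOver F₀ p → Prop) [∀ p, DecidablePred (bit p)]
    (hbit : ∀ p ∈ P, ∀ hp : p.Prime, haveI : Fact p.Prime := ⟨hp⟩; ∀ w : placesOver F₀ p, (I.σ.lift w.1).asIdeal.inertiaDeg ℤ = 1 → bit p w →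
      ∃ ψ ∈ ind1StripOf (I.σ.lift w.1) (galoisLog (I.σ.lift w.1)),
        RescaledCompletion.of K p (I.σ.lift w.1) (I.σ.natCast_mem_lift w) (ψ (p : (I.σ.lift w.1).adicCompletion K)) -
            (p : RescaledCompletion K p (I.σ.lift w.1) (I.σ.natCast_mem_lift w)) ∉
          (p : ℚ_[p]) • logUnits (RescaledCompletion K p (I.σ.lift w.1) (I.σ.natCast_mem_lift w)))
    (hfix : ∀ p ∈ P, ∀ hp : p.Prime, haveI : Fact p.Prime := ⟨hp⟩; ∀ w : placesOver F₀ p, (I.σ.lift w.1).asIdeal.inertiaDeg ℤ = 1 → ¬ bit p w →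
      ∀ ψ ∈ ind1StripOf (I.σ.lift w.1) (galoisLog (I.σ.lift w.1)),
        RescaledCompletion.of K p (I.σ.lift w.1) (I.σ.natCast_mem_lift w) (ψ (p : (I.σ.lift w.1).adicCompletion K)) -
            (p : RescaledCompletion K p (I.σ.lift w.1) (I.σ.natCast_mem_lift w)) ∈
          (p : ℚ_[p]) • logUnits (RescaledCompletion K p (I.σ.lift w.1) (I.σ.natCast_mem_lift w)))
    (hstrip : ∀ p ∈ P, ∀ hp : p.Prime, haveI : Fact p.Prime := ⟨hp⟩
      ∀ (i : Fin I.lstar) (e : Fin ((i : ℕ) + 1 + 1) → placesOver F₀ p) (b₀ : Fin ((i : ℕ) + 1 + 1)),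
        ∀ ψ ∈ ind1StripOf (I.σ.lift (e b₀).1) (galoisLog (I.σ.lift (e b₀).1)), ∃ γ ∈ H p hp ((i : ℕ) + 1) e,
          ∀ z : ∀ b, (I.σ.localFields p).k (e b),
            (γ : PacketAlgebra p (fun b => (I.σ.localFields p).k (e b)) ≃ₗ[ℚ_[p]]
                PacketAlgebra p (fun b => (I.σ.localFields p).k (e b))) (PiTensorProduct.tprod ℚ_[p] z) =
              PiTensorProduct.tprod ℚ_[p] (update z b₀
                (RescaledCompletion.of K p (I.σ.lift (e b₀).1) (I.σ.natCast_mem_lift (e b₀))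
                  (ψ ((RescaledCompletion.of K p (I.σ.lift (e b₀).1) (I.σ.natCast_mem_lift (e b₀))).symm (z b₀))))))
    (hHfac : ∀ p ∈ P, ∀ hp : p.Prime, haveI : Fact p.Prime := ⟨hp⟩
      ∀ (i : Fin I.lstar) (e : Fin ((i : ℕ) + 1 + 1) → placesOver F₀ p), ∀ γ ∈ H p hp ((i : ℕ) + 1) e,
        ∃ δ : Π b, AddAut ((I.σ.lift (e b).1).adicCompletion K),
          (∀ b, δ b ∈ AddSubgroup.closure (G := AddAut ((I.σ.lift (e b).1).adicCompletion K))
            (ind1StripOf (I.σ.lift (e b).1) (galoisLog (I.σ.lift (e b).1)))) ∧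
          ∀ z : Π b, (I.σ.localFields p).k (e b),
            (γ : PacketAlgebra p (fun b => (I.σ.localFields p).k (e b)) ≃ₗ[ℚ_[p]]
                PacketAlgebra p (fun b => (I.σ.localFields p).k (e b))) (PiTensorProduct.tprod ℚ_[p] z) =
              PiTensorProduct.tprod ℚ_[p] (fun b => RescaledCompletion.of K p (I.σ.lift (e b).1) (I.σ.natCast_mem_lift (e b))
                (δ b ((RescaledCompletion.of K p (I.σ.lift (e b).1) (I.σ.natCast_mem_lift (e b))).symm (z b)))))
    (hroom : ∀ p ∈ P, ∀ hp : p.Prime, haveI : Fact p.Prime := ⟨hp⟩; ∀ (i : Fin I.lstar) (e : Fin ((i : ℕ) + 1 + 1) → placesOver F₀ p), ∃ a,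
      (v p i e a - 1) / (absRamificationIdx p ((I.σ.localFields p).k (e a)) : ℤ) + 1 - Fintype.card (Fin ((i : ℕ) + 1 + 1)) =
          Finset.univ.inf' Finset.univ_nonempty
            (fun a => (v p i e a - 1) / (absRamificationIdx p ((I.σ.localFields p).k (e a)) : ℤ) + 1 - Fintype.card (Fin ((i : ℕ) + 1 + 1))) ∧
        (((v p i e a - 1) % (absRamificationIdx p ((I.σ.localFields p).k (e a)) : ℤ) + 1 : ℤ) : ℝ) /
            (absRamificationIdx p ((I.σ.localFields p).k (e a)) : ℝ) +
          ∑ b ∈ Finset.univ \ Finset.univ.filter (fun b => (I.σ.lift (e b).1).asIdeal.inertiaDeg ℤ ≠ 1 ∨ bit p (e b)),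
            (1 : ℝ) / (absRamificationIdx p ((I.σ.localFields p).k (e b)) : ℝ) ≤ 1) :
    (∑ p ∈ I.supportPrimes, if hp : p.Prime then
        (haveI : Fact p.Prime := ⟨hp⟩
        (I.packetAt p hp).lnνLp I.lstar (fun j e =>
          packetHull p (fun b => (I.σ.localFields p).k (e b))
            (⋃ g : H p hp j e, (g : PacketAlgebra p (fun b => (I.σ.localFields p).k (e b)) ≃ₗ[ℚ_[p]]
                PacketAlgebra p (fun b => (I.σ.localFields p).k (e b))) ''
              ⋃ τ : Equiv.Perm (Fin (j + 1)), (I.packetAt p hp).perm τ e '' (I.packetAt p hp).pilotRegion (I.tΘ p hp) j (e ∘ τ)))) else 0) =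
      I.negLogThetaNonarch ↔
    ∀ p ∈ I.supportPrimes \ P, (if hp : p.Prime then
        (haveI : Fact p.Prime := ⟨hp⟩
        (I.packetAt p hp).lnνLp I.lstar (fun j e =>
          packetHull p (fun b => (I.σ.localFields p).k (e b))
            (⋃ g : H p hp j e, (g : PacketAlgebra p (fun b => (I.σ.localFields p).k (e b)) ≃ₗ[ℚ_[p]]
                PacketAlgebra p (fun b => (I.σ.localFields p).k (e b))) ''
              ⋃ τ : Equiv.Perm (Fin (j + 1)), (I.packetAt p hp).perm τ e '' (I.packetAt p hp).pilotRegion (I.tΘ p hp) j (e ∘ τ)))) else 0) =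
      I.negLogThetaLoc p := by
  rw [I.sum_lnνLp_hull_orbitH_indOneUnion_eq_negLogThetaNonarch_iff_forall_eq H hH]
  refine ⟨fun h p hp => h p (Finset.mem_sdiff.mp hp).1, fun h p hpT => ?_⟩
  by_cases hpP : p ∈ P
  · have hp : p.Prime := I.prime_of_mem_supportPrimes (hPT hpP)
    exact I.dif_lnνLp_hull_orbitH_indOneUnion_eq_negLogThetaLoc_of_forall_exists_room_at_min_of_jannsenWingbergMappingClass hMC hp (hP2 p hpP)
      (he p hpP hp) (h3 p hpP) (hodd p hpP) (v p) (hv p hpP hp) (bit p) (hbit p hpP hp) (hfix p hpP hp) (H p hp) (hH p hp) (hstrip p hpP hp)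
      (hHfac p hpP hp) (hroom p hpP hp)
  · exact h p (Finset.mem_sdiff.mpr ⟨hpT, hpP⟩)

/-- **CLAIM FORMS ON THE IDENTITY LOCUS, reading (U).**  Where the reading-(U) Θ-side over `H` EQUALS `−|log(Θ)|^{nonarch}`, «Cor 3.12's nonarchimedean
(U)-form over `H`» and abc-iut-S2's `Cor312NonarchOf I` are the SAME inequality (with p588683 §4: equivalent ON the locus, tighter OFF it).  Bookkeeping between
two `Prop`s; neither is asserted. [claim: Mochizuki2012, status: disputed] [cite: Mochizuki2012, IUTchIII Cor. 3.12 pp. 173–174] [cite: DupuyHilado2025, §1 (1.1)] -/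
theorem negAbsLogQ_le_sum_indOneUnion_iff_cor312NonarchOf_of_sum_eq
    (H : ∀ (p : ℕ) (hp : p.Prime), haveI : Fact p.Prime := ⟨hp⟩
      (j : ℕ) → (e : Fin (j + 1) → placesOver F₀ p) →
        Subgroup (PacketAlgebra p (fun b => (I.σ.localFields p).k (e b)) ≃ₗ[ℚ_[p]]
          PacketAlgebra p (fun b => (I.σ.localFields p).k (e b))))
    (hEq : (∑ p ∈ I.supportPrimes, if hp : p.Prime then
        (haveI : Fact p.Prime := ⟨hp⟩
        (I.packetAt p hp).lnνLp I.lstar (fun j e =>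
          packetHull p (fun b => (I.σ.localFields p).k (e b))
            (⋃ g : H p hp j e, (g : PacketAlgebra p (fun b => (I.σ.localFields p).k (e b)) ≃ₗ[ℚ_[p]]
                PacketAlgebra p (fun b => (I.σ.localFields p).k (e b))) ''
              ⋃ τ : Equiv.Perm (Fin (j + 1)), (I.packetAt p hp).perm τ e '' (I.packetAt p hp).pilotRegion (I.tΘ p hp) j (e ∘ τ)))) else 0) =
      I.negLogThetaNonarch) :
    (I.negAbsLogQ ≤ ∑ p ∈ I.supportPrimes, if hp : p.Prime then
        (haveI : Fact p.Prime := ⟨hp⟩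
        (I.packetAt p hp).lnνLp I.lstar (fun j e =>
          packetHull p (fun b => (I.σ.localFields p).k (e b))
            (⋃ g : H p hp j e, (g : PacketAlgebra p (fun b => (I.σ.localFields p).k (e b)) ≃ₗ[ℚ_[p]]
                PacketAlgebra p (fun b => (I.σ.localFields p).k (e b))) ''
              ⋃ τ : Equiv.Perm (Fin (j + 1)), (I.packetAt p hp).perm τ e '' (I.packetAt p hp).pilotRegion (I.tΘ p hp) j (e ∘ τ)))) else 0) ↔
      I.Cor312NonarchOf := by
  rw [hEq]
  rfl

/-- **NON-VACUITY: the three hypotheses on the PRIME-INDEXED family `H = (H_{p,j,v⃗})` are jointly inhabited at EVERY prime at once (UNCONDITIONAL).**  Choosing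
at every prime p587766 §4's family (generated by the single-factor (Ind1) strip moves inside `indTwo`) gives ONE prime-indexed family `≤ indTwo` containing
every single-factor strip move and acting factorwise, at every `p` and every collection — both files speak about an inhabited class.  The ARITHMETIC hypotheses
(tame, odd local degree `≥ 3`, bit values, valuation families) are properties of the input and are NOT witnessed here. [claim: Mochizuki2012, status: disputed]
[cite: Mochizuki2012, IUTchIII Thm. 3.11 (i) p. 154] [cite: DupuyHilado2025, §4.9] -/
theorem exists_primeIndexedFamily_le_indTwo_stripMoves_factorwise :
    ∃ H : ∀ (p : ℕ) (hp : p.Prime), haveI : Fact p.Prime := ⟨hp⟩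
      (j : ℕ) → (e : Fin (j + 1) → placesOver F₀ p) →
        Subgroup (PacketAlgebra p (fun b => (I.σ.localFields p).k (e b)) ≃ₗ[ℚ_[p]]
          PacketAlgebra p (fun b => (I.σ.localFields p).k (e b))),
      (∀ (p : ℕ) (hp : p.Prime), haveI : Fact p.Prime := ⟨hp⟩; ∀ j e, H p hp j e ≤ indTwo p (fun b => (I.σ.localFields p).k (e b))) ∧
      (∀ (p : ℕ) (hp : p.Prime), haveI : Fact p.Prime := ⟨hp⟩;
        ∀ (i : Fin I.lstar) (e : Fin ((i : ℕ) + 1 + 1) → placesOver F₀ p) (b₀ : Fin ((i : ℕ) + 1 + 1)),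
          ∀ ψ ∈ ind1StripOf (I.σ.lift (e b₀).1) (galoisLog (I.σ.lift (e b₀).1)), ∃ γ ∈ H p hp ((i : ℕ) + 1) e,
            ∀ z : ∀ b, (I.σ.localFields p).k (e b),
              (γ : PacketAlgebra p (fun b => (I.σ.localFields p).k (e b)) ≃ₗ[ℚ_[p]]
                  PacketAlgebra p (fun b => (I.σ.localFields p).k (e b))) (PiTensorProduct.tprod ℚ_[p] z) =
                PiTensorProduct.tprod ℚ_[p] (update z b₀
                  (RescaledCompletion.of K p (I.σ.lift (e b₀).1) (I.σ.natCast_mem_lift (e b₀))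
                    (ψ ((RescaledCompletion.of K p (I.σ.lift (e b₀).1) (I.σ.natCast_mem_lift (e b₀))).symm (z b₀)))))) ∧
      ∀ (p : ℕ) (hp : p.Prime), haveI : Fact p.Prime := ⟨hp⟩;
        ∀ (i : Fin I.lstar) (e : Fin ((i : ℕ) + 1 + 1) → placesOver F₀ p), ∀ γ ∈ H p hp ((i : ℕ) + 1) e,
          ∃ δ : Π b, AddAut ((I.σ.lift (e b).1).adicCompletion K),
            (∀ b, δ b ∈ AddSubgroup.closure (G := AddAut ((I.σ.lift (e b).1).adicCompletion K))
              (ind1StripOf (I.σ.lift (e b).1) (galoisLog (I.σ.lift (e b).1)))) ∧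
            ∀ z : Π b, (I.σ.localFields p).k (e b),
              (γ : PacketAlgebra p (fun b => (I.σ.localFields p).k (e b)) ≃ₗ[ℚ_[p]]
                  PacketAlgebra p (fun b => (I.σ.localFields p).k (e b))) (PiTensorProduct.tprod ℚ_[p] z) =
                PiTensorProduct.tprod ℚ_[p] (fun b => RescaledCompletion.of K p (I.σ.lift (e b).1) (I.σ.natCast_mem_lift (e b))
                  (δ b ((RescaledCompletion.of K p (I.σ.lift (e b).1) (I.σ.natCast_mem_lift (e b))).symm (z b)))) := by
  choose H hH hstrip hHfac using fun (p : ℕ) (hp : p.Prime) =>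
    (haveI : Fact p.Prime := ⟨hp⟩; exists_subgroupFamily_le_indTwo_stripMoves_factorwise I.σ p I.lstar)
  exact ⟨H, hH, hstrip, hHfac⟩

end Literature.IUT.LogVolume.ThetaVolumeInput

end
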